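import Literature.Analysis.SpecialFunctions.GammaVerticalBounds
import HarnessLib

/-!
# An explicit lower bound for `|Γ|` on the vertical lines `Re z = 1/2 + n`

For every `n : ℕ` and `y : ℝ`,

  `√π · e^{-π|y|/2} · 2^{-n} ≤ |Γ(1/2 + n + iy)|`

(`GammaVert.norm_Gamma_half_add_nat_add_mul_I_ge`). At `n = 0` this is the reflection
formula `|Γ(1/2 + iy)|² = π / cosh(πy)` (`GammaVert.norm_sq_Gamma_half`,
`GammaVerticalBounds.lean`) with `cosh(πy) ≤ e^{π|y|}`; the general case is induction on `n`
with `Γ(z + 1) = z Γ(z)` and `|1/2 + n + iy| ≥ 1/2`. Elementary; Titchmarsh 1986 §4.42 records the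
true order `|Γ(σ + iy)| ≍ |y|^{σ - 1/2} e^{-π|y|/2}`, of which this is the cheap half that keeps
`log (1/|Γ|)` linear in `|y|` — the form consumed by Jensen- and Landau-disc arguments for `ξ`.

This is the topical home of the statement formerly vended as the named fact
`Literature.Uncategorized.GammaLowerBound` (gate relocation from a Summits proposal, 2026-08-16);
that name and its discharge `Literature.Uncategorized.GammaLowerBound_holds` are kept there as
one-line consequences of the theorem below (librarian refactor wi-35549).

## References
* E. C. Titchmarsh, *The Theory of the Riemann Zeta-Function*, 2nd ed. (1986), §4.42.
  [Titchmarsh1986]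
-/

noncomputable section

namespace Literature.Analysis.SpecialFunctions.GammaVert

open Complex

/-- **Lower bound for `|Γ|` on the lines `Re z = 1/2 + n`.** For all `n : ℕ`, `y : ℝ`:
`√π · e^{-π|y|/2} · (1/2)^n ≤ |Γ(1/2 + n + iy)|`. Base case from the reflection formula
`|Γ(1/2+iy)|² = π/cosh(πy)` (`norm_sq_Gamma_half`) and `cosh(πy) ≤ e^{π|y|}`; step from
`Γ(z+1) = zΓ(z)` and `|1/2 + n + iy| ≥ Re = 1/2 + n ≥ 1/2`. [folklore] -/
theorem norm_Gamma_half_add_nat_add_mul_I_ge (n : ℕ) (y : ℝ) :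
    Real.sqrt Real.pi * Real.exp (-(Real.pi / 2) * |y|) * (1 / 2) ^ n ≤
      ‖Complex.Gamma (1 / 2 + n + y * I)‖ := by
  induction n with
  | zero =>
    -- the line `Re z = 1/2`: `|Γ(1/2 + iy)|² = π / cosh(πy) ≥ π e^{-π|y|}`
    have hsq := norm_sq_Gamma_half y
    have hcosh : (0 : ℝ) < Real.cosh (Real.pi * y) := Real.cosh_pos _
    have hcosh_le : Real.cosh (Real.pi * y) ≤ Real.exp (Real.pi * |y|) := by
      rw [Real.cosh_eq, ← abs_of_pos Real.pi_pos, ← abs_mul, abs_of_pos Real.pi_pos]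
      have h1 : Real.exp (Real.pi * y) ≤ Real.exp |Real.pi * y| :=
        Real.exp_le_exp.2 (le_abs_self _)
      have h2 : Real.exp (-(Real.pi * y)) ≤ Real.exp |Real.pi * y| :=
        Real.exp_le_exp.2 (neg_le_abs _)
      linarith
    have hlhs_nonneg : 0 ≤ Real.sqrt Real.pi * Real.exp (-(Real.pi / 2) * |y|) := by positivity
    have h0 : Real.sqrt Real.pi * Real.exp (-(Real.pi / 2) * |y|) ≤
        ‖Complex.Gamma (1 / 2 + y * I)‖ := by
      rw [← abs_of_nonneg hlhs_nonneg,
        ← abs_of_nonneg (norm_nonneg (Complex.Gamma (1 / 2 + y * I))), ← sq_le_sq, hsq, mul_pow,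
        Real.sq_sqrt Real.pi_pos.le, ← Real.exp_nat_mul, le_div_iff₀ hcosh]
      have hexp :
          Real.exp ((2 : ℕ) * (-(Real.pi / 2) * |y|)) * Real.exp (Real.pi * |y|) = 1 := by
        rw [← Real.exp_add]
        convert Real.exp_zero using 2
        push_cast
        ring
      calc Real.pi * Real.exp ((2 : ℕ) * (-(Real.pi / 2) * |y|)) * Real.cosh (Real.pi * y)
          ≤ Real.pi * Real.exp ((2 : ℕ) * (-(Real.pi / 2) * |y|)) * Real.exp (Real.pi * |y|) :=
            by gcongr
        _ = Real.pi := by rw [mul_assoc, hexp, mul_one]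
    simpa using h0
  | succ n ih =>
    have hz : (1 / 2 + (n : ℂ) + y * I) ≠ 0 := by
      intro h
      have := congrArg Complex.re h
      simp at this
      linarith [n.cast_nonneg (α := ℝ)]
    have hstep : Complex.Gamma (1 / 2 + ((n + 1 : ℕ) : ℂ) + y * I) =
        (1 / 2 + (n : ℂ) + y * I) * Complex.Gamma (1 / 2 + (n : ℂ) + y * I) := by
      rw [← Complex.Gamma_add_one _ hz]
      congr 1
      push_cast
      ring
    rw [hstep, norm_mul]
    have hre : (1 / 2 : ℝ) ≤ ‖(1 / 2 + (n : ℂ) + y * I)‖ := by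
      refine le_trans ?_ (Complex.abs_re_le_norm _)
      simp
      rw [abs_of_nonneg (by positivity)]
      linarith [n.cast_nonneg (α := ℝ)]
    have hpos : 0 ≤ Real.sqrt Real.pi * Real.exp (-(Real.pi / 2) * |y|) * (1 / 2) ^ n := by
      positivity
    calc Real.sqrt Real.pi * Real.exp (-(Real.pi / 2) * |y|) * (1 / 2) ^ (n + 1)
        = (1 / 2) * (Real.sqrt Real.pi * Real.exp (-(Real.pi / 2) * |y|) * (1 / 2) ^ n) := by
          ring
      _ ≤ ‖(1 / 2 + (n : ℂ) + y * I)‖ * ‖Complex.Gamma (1 / 2 + (n : ℂ) + y * I)‖ :=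
        mul_le_mul hre ih hpos (norm_nonneg _)

end Literature.Analysis.SpecialFunctions.GammaVert

end
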